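/-
Copyright (c) 2026. All rights reserved.
Released under Apache 2.0 license as described in the file LICENSE.
-/
import Literature.NumberTheory.GaloisRepresentations.HOneRestrictionOntoInvariants
import HarnessLib

/-!
# The unramified part `ker(H¹(G, X) → H¹(N, X)) ≅ X^N / (φ − 1) X^N` for a free procyclic quotient
# and arbitrary (Hausdorff) topological coefficients — "`H¹(Ẑ, T) = T/(F − 1)T`" for profinite `T`

Topic `NumberTheory/GaloisRepresentations`; namespace `Literature.NumberTheory.GaloisRepresentations`.
THEOREMS ONLY (no definition, no named fact).  Companion of `HOneRestrictionOntoInvariants.lean`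
(the right end `H¹(G, X) ↠ H¹(N, X)^{G/N}`); here the LEFT end of
`0 → H¹(G/N, X^N) → H¹(G, X) → H¹(N, X)^{G/N} → 0` is made explicit for ARBITRARY Hausdorff
topological coefficients `X` (profinite `T` allowed), in the concrete form in which Kolyvagin-system
arguments use it: the "unramified classes" `H¹_ur := ker(res_N)` are computed by the VALUE AT THE
GENERATOR of an `N`-vanishing representative,

  `H¹_ur(G, X) = ker(res_N) ⥲ X^N / (φ − 1) X^N`,  `[z] ↦ z(φ)`  (`z|_N = 0`),

for `G = N ⋊ C` with `C = cl⟨φ⟩` free procyclic (e.g. `G = Γ_K`, `N = I_K`, `φ` a Frobenius lift: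
`H¹_ur(K, T) = H¹(K^nr/K, T^{I}) ≅ T^{I}/(Fr − 1)T^{I}`; Serre, *Local Fields* XIII §1; Rubin,
*Euler Systems*, Lemma 1.3.2 and App. B §2; Neukirch–Schmidt–Wingberg (1.6.7)).  Precisely:

* `exists_rep_vanishing_of_resSubgroup_eq_zero` — a class killed by `res_N` has a representative
  vanishing on `N`; `apply_mem_invariants_of_vanishing` — such a cocycle is `X^N`-valued;
  `resSubgroup_oneCocycleClass_eq_zero_of_vanishing` — conversely;
* `oneCocycleClass_eq_iff_of_vanishing` — **injectivity / well-definedness**: two `N`-vanishing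
  cocycles have the same class iff their values at `φ` differ by `(φ − 1)v` with `v ∈ X^N` (the
  cocycle `z − z' − ∂v` vanishes on the dense set `N·⟨φ⟩`);
* `exists_vanishing_apply_eq` — **surjectivity**: every `t ∈ X^N` is `z(φ)` for an `N`-vanishing
  continuous cocycle `z` of `G`, given (KM4) a continuous cocycle `y` of `C` with `y(φ) = t` (its values
  are `N`-invariant by density, and `z(g) := y(r g)` along the retraction `r : G → C`);
* the free-procyclic packaging `…_of_isFreeProcyclic` (tree:
  `Literature.GroupTheory.exists_continuousMonoidHom_retraction_of_isFreeProcyclic`,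
  `dense_mul_zpowers_of_dense`).

(KM4) holds for finite discrete `X` (`HOneRestrictionOntoInvariantsFinite`) and for profinite `X`.
[cite: SerreLocalFields1979, XIII §1 Prop. 1] [cite: Rubin2000, Lemma 1.3.2]
-/

noncomputable section

open CategoryTheory

universe u v

namespace Literature.NumberTheory.GaloisRepresentations

open Literature.NumberTheory.EllipticCurves (subgroupConj subgroupConj_apply_coe)
open _root_.Subgroup _root_.Topology
open scoped Pointwise

variable {R : Type u} [CommRing R] [TopologicalSpace R]
variable {G : Type v} [Group G] [TopologicalSpace G] [IsTopologicalGroup G]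
variable (X : TopRep.{v} R G)

/-! ### `N`-vanishing representatives of unramified classes -/

section Vanishing

variable {N : Subgroup G}

omit [IsTopologicalGroup G] in
/-- Continuity of an orbit map from joint continuity. [folklore] -/
private theorem continuous_orbit (hXc : Continuous fun p : G × X => X.ρ p.1 p.2) (w : X) :
    Continuous fun g : G => X.ρ g w :=
  hXc.comp (continuous_id.prodMk continuous_const)

/-- **A class killed by `res : H¹(G, X) → H¹(N, X)` has a representative VANISHING on `N`**
(subtract the coboundary `∂w` given by `res [z₀] = 0`). [cite: SerreGaloisCohomology1997, I §2.6 (b)] -/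
theorem exists_rep_vanishing_of_resSubgroup_eq_zero (hXc : Continuous fun p : G × X => X.ρ p.1 p.2)
    (c : continuousCohomology 1 X) (hc : resSubgroup X N 1 c = 0) :
    ∃ z : contOneCocycles X, oneCocycleClass X z = c ∧ ∀ n : N, z.1 n = 0 := by
  obtain ⟨z₀, rfl⟩ := oneCocycleClass_surjective X c
  rw [resSubgroup_oneCocycleClass, oneCocycleClass_eq_zero_iff] at hc
  obtain ⟨w, hw⟩ := hc
  let δ : contOneCocycles X :=
    ⟨⟨fun g => X.ρ g w - w, (continuous_orbit X hXc w).sub continuous_const⟩, fun g h => by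
      change X.ρ (g * h) w - w = (X.ρ g w - w) + X.ρ g (X.ρ h w - w)
      rw [map_sub, ρ_mul_apply]; abel⟩
  have hδ : oneCocycleClass X δ = 0 := (oneCocycleClass_eq_zero_iff X δ).mpr ⟨w, fun _ => rfl⟩
  refine ⟨z₀ - δ, by rw [oneCocycleClass_sub, hδ, sub_zero], fun n => ?_⟩
  have h := hw n
  rw [resSubgroup_pullback_apply] at h
  change z₀.1 n - (X.ρ (n : G) w - w) = 0
  rw [h, subgroupRep_ρ_apply, sub_self]

/-- Conversely an `N`-vanishing cocycle restricts to the zero class (its class is "unramified").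
[cite: SerreGaloisCohomology1997, I §2.6 (b)] -/
theorem resSubgroup_oneCocycleClass_eq_zero_of_vanishing (z : contOneCocycles X) (hz : ∀ n : N, z.1 n = 0) :
    resSubgroup X N 1 (oneCocycleClass X z) = 0 := by
  rw [resSubgroup_oneCocycleClass]
  have : contOneCocycles.pullback (subgroupSubtypeHom N) (Y := subgroupRep X N)
      (TopRep.ofHom ⟨ContinuousLinearMap.id R X, fun _ => rfl⟩) z = 0 :=
    Subtype.ext (ContinuousMap.ext fun n => by rw [resSubgroup_pullback_apply, hz n]; rfl)
  rw [this, oneCocycleClass_zero]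

omit [IsTopologicalGroup G] in
/-- **An `N`-vanishing cocycle is `X^N`-valued** (`N` normal): `n·z(g) = z(n g) = z(g·g⁻¹ng) = z(g)`.
[cite: SerreGaloisCohomology1997, I §2.6 (b)] -/
theorem apply_mem_invariants_of_vanishing [N.Normal] (z : contOneCocycles X) (hz : ∀ n : N, z.1 n = 0)
    (g : G) (n : N) : X.ρ (n : G) (z.1 g) = z.1 g := by
  have h1 : z.1 ((n : G) * g) = X.ρ (n : G) (z.1 g) := by rw [z.2, hz n, zero_add]
  have hn' : g⁻¹ * (n : G) * g ∈ N := Subgroup.Normal.conj_mem' inferInstance (n : G) n.2 g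
  have h2 : z.1 ((n : G) * g) = z.1 g := by
    have e : (n : G) * g = g * (g⁻¹ * (n : G) * g) := by group
    rw [e, z.2 g, hz ⟨_, hn'⟩, map_zero, add_zero]
  rw [← h1, h2]

omit [IsTopologicalGroup G] in
/-- An `N`-vanishing cocycle vanishing at `ψ` vanishes on `N · ⟨ψ⟩`. [folklore] -/
private theorem apply_eq_zero_of_vanishing_of_apply_eq_zero (z : contOneCocycles X)
    (hz : ∀ n : N, z.1 n = 0) {ψ : G} (hψ : z.1 ψ = 0) {g : G}
    (hg : g ∈ (N : Set G) * (zpowers ψ : Set G)) : z.1 g = 0 := by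
  -- `z` vanishes on the subgroup `⟨ψ⟩`
  have hpow : ∀ c ∈ zpowers ψ, z.1 c = 0 := by
    let S : Subgroup G :=
      { carrier := {c | z.1 c = 0}
        one_mem' := contOneCocycles.apply_one z
        mul_mem' := fun {a b} ha hb => by
          change z.1 (a * b) = 0
          rw [z.2 a b, ha, hb, map_zero, add_zero]
        inv_mem' := fun {a} ha => by
          change z.1 a⁻¹ = 0
          have h := z.2 a⁻¹ a
          rw [inv_mul_cancel, contOneCocycles.apply_one, ha, map_zero, add_zero] at h
          exact h.symm }
    exact fun c hc => (zpowers_le (H := S)).mpr hψ hc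
  obtain ⟨n, hn, c, hc, rfl⟩ := Set.mem_mul.mp hg
  rw [z.2 n c, hz ⟨n, hn⟩, hpow c hc, map_zero, add_zero]

variable [T2Space X]

/-- **Injectivity / well-definedness of `[z] ↦ z(ψ) mod (ψ − 1)X^N` on unramified classes.** For
`N`-vanishing continuous cocycles `z, z'` of `G` and `ψ ∈ G` with `N·⟨ψ⟩` dense in `G`:
`[z] = [z']` iff `z(ψ) − z'(ψ) = (ψ − 1)v` for some `N`-invariant `v` (then `z − z' − ∂v` vanishes on
`N·⟨ψ⟩`, hence everywhere). [cite: SerreLocalFields1979, XIII §1 Prop. 1] [cite: Rubin2000, Lemma 1.3.2] -/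
theorem oneCocycleClass_eq_iff_of_vanishing (hXc : Continuous fun p : G × X => X.ρ p.1 p.2)
    {ψ : G} (hdense : Dense ((N : Set G) * (zpowers ψ : Set G)))
    (z z' : contOneCocycles X) (hz : ∀ n : N, z.1 n = 0) (hz' : ∀ n : N, z'.1 n = 0) :
    oneCocycleClass X z = oneCocycleClass X z' ↔
      ∃ v : X, (∀ n : N, X.ρ (n : G) v = v) ∧ z.1 ψ - z'.1 ψ = X.ρ ψ v - v := by
  constructor
  · intro h
    have h0 : oneCocycleClass X (z - z') = 0 := by rw [oneCocycleClass_sub, h, sub_self]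
    obtain ⟨v, hv⟩ := (oneCocycleClass_eq_zero_iff X _).mp h0
    refine ⟨v, fun n => ?_, hv ψ⟩
    have := hv n
    rw [Submodule.coe_sub, ContinuousMap.sub_apply, hz n, hz' n, sub_self] at this
    exact (sub_eq_zero.mp this.symm)
  · rintro ⟨v, hvN, hv⟩
    let δ : contOneCocycles X :=
      ⟨⟨fun g => X.ρ g v - v, (continuous_orbit X hXc v).sub continuous_const⟩, fun g h => by
        change X.ρ (g * h) v - v = (X.ρ g v - v) + X.ρ g (X.ρ h v - v)
        rw [map_sub, ρ_mul_apply]; abel⟩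
    have hδ : oneCocycleClass X δ = 0 := (oneCocycleClass_eq_zero_iff X δ).mpr ⟨v, fun _ => rfl⟩
    set w : contOneCocycles X := z - z' - δ with hwdef
    have hwN : ∀ n : N, w.1 n = 0 := fun n => by
      change z.1 n - z'.1 n - (X.ρ (n : G) v - v) = 0
      rw [hz n, hz' n, hvN n]; abel
    have hwψ : w.1 ψ = 0 := by
      change z.1 ψ - z'.1 ψ - (X.ρ ψ v - v) = 0
      rw [hv, sub_self]
    have hw0 : w = 0 := by
      refine Subtype.ext (ContinuousMap.ext fun g => ?_)
      have heq : (fun g => w.1 g) = fun _ => (0 : X) :=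
        Continuous.ext_on hdense w.1.continuous continuous_const fun g hg =>
          apply_eq_zero_of_vanishing_of_apply_eq_zero X w hwN hwψ hg
      exact congrFun heq g
    have : z = z' + δ + w := by rw [hwdef]; abel
    rw [this, oneCocycleClass_add, oneCocycleClass_add, hδ, hw0, oneCocycleClass_zero, add_zero, add_zero]

/-- In particular, for `N`-vanishing `z`: `[z] = 0 ↔ z(ψ) ∈ (ψ − 1)X^N`.
[cite: SerreLocalFields1979, XIII §1 Prop. 1] -/
theorem oneCocycleClass_eq_zero_iff_of_vanishing (hXc : Continuous fun p : G × X => X.ρ p.1 p.2)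
    {ψ : G} (hdense : Dense ((N : Set G) * (zpowers ψ : Set G)))
    (z : contOneCocycles X) (hz : ∀ n : N, z.1 n = 0) :
    oneCocycleClass X z = 0 ↔ ∃ v : X, (∀ n : N, X.ρ (n : G) v = v) ∧ z.1 ψ = X.ρ ψ v - v := by
  rw [← oneCocycleClass_zero X, oneCocycleClass_eq_iff_of_vanishing X hXc hdense z 0 hz fun _ => rfl]
  simp

end Vanishing

/-! ### Surjectivity: every `N`-invariant `t` is the value at the generator of an unramified cocycle -/

section Surjective

variable {N C : Subgroup G} [N.Normal] [T2Space X]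

omit [IsTopologicalGroup G] in
/-- The values of a continuous cocycle `y` of `C` with `y(ψ) ∈ X^N`, `⟨ψ⟩` dense in `C`, are all
`N`-invariant (the set of such `c` is a closed subgroup of `C`; `N ⊴ G`). [folklore] -/
private theorem forall_apply_mem_invariants (y : contOneCocycles (subgroupRep X C)) {ψ : C}
    (hdense : Dense (zpowers ψ : Set C)) (hψ : ∀ n : N, X.ρ (n : G) (y.1 ψ) = y.1 ψ) (c : C) (n : N) :
    X.ρ (n : G) (y.1 c) = y.1 c := by
  let S : Subgroup C :=
    { carrier := {c | ∀ n : N, X.ρ (n : G) (y.1 c) = y.1 c}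
      one_mem' := fun n => by
        change X.ρ (n : G) (y.1 1) = y.1 1
        rw [contOneCocycles.apply_one, map_zero]
      mul_mem' := fun {a b} ha hb n => by
        change X.ρ (n : G) (y.1 (a * b)) = y.1 (a * b)
        have hn' : (a : G)⁻¹ * (n : G) * (a : G) ∈ N := Subgroup.Normal.conj_mem' inferInstance (n : G) n.2 (a : G)
        rw [y.2 a b, map_add, ha n, subgroupRep_ρ_apply, ← ρ_mul_apply,
          show (n : G) * (a : G) = (a : G) * ((a : G)⁻¹ * (n : G) * (a : G)) by group, ρ_mul_apply,
          hb ⟨_, hn'⟩]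
      inv_mem' := fun {a} ha n => by
        change X.ρ (n : G) (y.1 a⁻¹) = y.1 a⁻¹
        have hy : y.1 a⁻¹ = -X.ρ ((a : G)⁻¹) (y.1 a) := by
          have h := y.2 a⁻¹ a
          rw [inv_mul_cancel, contOneCocycles.apply_one] at h
          rw [eq_neg_iff_add_eq_zero]; exact h.symm
        have hn' : (a : G) * (n : G) * (a : G)⁻¹ ∈ N := by
          have := Subgroup.Normal.conj_mem inferInstance (n : G) n.2 (a : G)
          simpa using this
        rw [hy, map_neg, ← ρ_mul_apply,
          show (n : G) * (a : G)⁻¹ = (a : G)⁻¹ * ((a : G) * (n : G) * (a : G)⁻¹) by group, ρ_mul_apply,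
          ha ⟨_, hn'⟩] }
  have hcl : IsClosed (S : Set C) := by
    have : (S : Set C) = ⋂ n : N, {c : C | X.ρ (n : G) (y.1 c) = y.1 c} := by ext c; simp [S]
    rw [this]
    exact isClosed_iInter fun n => isClosed_eq ((X.ρ (n : G)).continuous.comp y.1.continuous) y.1.continuous
  have hsub : (zpowers ψ : Set C) ⊆ S := fun c hc => (zpowers_le (H := S)).mpr hψ hc
  have hall := hdense.closure_eq ▸ closure_minimal hsub hcl
  exact (hall (Set.mem_univ c)) n

omit [IsTopologicalGroup G] in
/-- **Surjectivity of `H¹_ur(G, X) → X^N/(ψ − 1)X^N`.** Let `r : G → G` be a continuous homomorphic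
retraction onto `C` with kernel `N`, `ψ ∈ C` a topological generator, and `t ∈ X^N`.  If (KM4) some
continuous cocycle `y` of `C` has `y(ψ) = t`, then `z(g) := y(r g)` is a continuous cocycle of `G`
VANISHING on `N` with `z(ψ) = t`. [cite: SerreLocalFields1979, XIII §1 Prop. 1] [cite: Rubin2000, Lemma 1.3.2] -/
theorem exists_vanishing_apply_eq (r : G →ₜ* G) (hrC : ∀ g, r g ∈ C) (hrid : ∀ c ∈ C, r c = c)
    (hker : ∀ g, r g = 1 ↔ g ∈ N) {ψ : C} (hdense : Dense (zpowers ψ : Set C))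
    {t : X} (ht : ∀ n : N, X.ρ (n : G) t = t)
    (hKM4 : ∃ y : contOneCocycles (subgroupRep X C), y.1 ψ = t) :
    ∃ z : contOneCocycles X, (∀ n : N, z.1 n = 0) ∧ z.1 (ψ : G) = t := by
  obtain ⟨y, hy⟩ := hKM4
  have hinv : ∀ (c : C) (n : N), X.ρ (n : G) (y.1 c) = y.1 c :=
    forall_apply_mem_invariants X y hdense (fun n => by rw [hy]; exact ht n)
  have hmem : ∀ g, g * (r g)⁻¹ ∈ N := Literature.GroupTheory.mul_inv_retraction_mem r hrC hrid hker
  let cOf : G → C := fun g => ⟨r g, hrC g⟩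
  have hcOf : Continuous cOf := Continuous.subtype_mk (map_continuous r) _
  let f : G → X := fun g => y.1 (cOf g)
  have hcocycle : ∀ g h, f (g * h) = f g + X.ρ g (f h) := by
    intro g h
    have hcgh : cOf (g * h) = cOf g * cOf h := Subtype.ext (by change r (g * h) = r g * r h; rw [map_mul])
    change y.1 (cOf (g * h)) = y.1 (cOf g) + X.ρ g (y.1 (cOf h))
    rw [hcgh, y.2, subgroupRep_ρ_apply]
    congr 1
    -- `g = (g (r g)⁻¹) · r g` and `(r g)·y(r h)` is `N`-invariant
    have e : g = (g * (r g)⁻¹) * ((cOf g : C) : G) := by change g = g * (r g)⁻¹ * r g; rw [inv_mul_cancel_right]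
    conv_rhs => rw [e, ρ_mul_apply]
    have hn' : ((cOf g : C) : G)⁻¹ * (g * (r g)⁻¹) * ((cOf g : C) : G) ∈ N :=
      Subgroup.Normal.conj_mem' inferInstance _ (hmem g) _
    rw [← ρ_mul_apply (X := X) (g * (r g)⁻¹),
      show (g * (r g)⁻¹) * ((cOf g : C) : G) = ((cOf g : C) : G) * (((cOf g : C) : G)⁻¹ * (g * (r g)⁻¹) *
        ((cOf g : C) : G)) by group, ρ_mul_apply, hinv (cOf h) ⟨_, hn'⟩]
  refine ⟨⟨⟨f, y.1.continuous.comp hcOf⟩, hcocycle⟩, fun n => ?_, ?_⟩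
  · have h1 : cOf n = 1 := Subtype.ext ((hker n).mpr n.2)
    change y.1 (cOf n) = 0
    rw [h1, contOneCocycles.apply_one]
  · have h1 : cOf ψ = ψ := Subtype.ext (hrid ψ ψ.2)
    change y.1 (cOf ψ) = t
    rw [h1, hy]

end Surjective

/-! ### Free procyclic quotients -/

section FreeProcyclic

open Literature.AnabelianGeometry.AbsoluteAnabelian Literature.GroupTheory

variable [CompactSpace G] [T2Space G] [TotallyDisconnectedSpace G] [T2Space X]

omit [CompactSpace G] [T2Space G] [TotallyDisconnectedSpace G] in
/-- **`H¹_ur(G, X) ↪ X^N/(φ − 1)X^N`**: for `G` profinite, `N ⊴ G` closed, `φ ∈ G` whose image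
topologically generates `G ⧸ N`, and `X` Hausdorff with jointly continuous action, two `N`-vanishing
continuous cocycles have the same class iff their values at `φ` differ by `(φ − 1)v`, `v ∈ X^N`.
[cite: SerreLocalFields1979, XIII §1 Prop. 1] [cite: Rubin2000, Lemma 1.3.2] -/
theorem oneCocycleClass_eq_iff_of_vanishing_of_dense (hXc : Continuous fun p : G × X => X.ρ p.1 p.2)
    (N : Subgroup G) [N.Normal] (φ : G)
    (hφ : Dense (zpowers (QuotientGroup.mk φ : G ⧸ N) : Set (G ⧸ N)))
    (z z' : contOneCocycles X) (hz : ∀ n : N, z.1 n = 0) (hz' : ∀ n : N, z'.1 n = 0) :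
    oneCocycleClass X z = oneCocycleClass X z' ↔
      ∃ v : X, (∀ n : N, X.ρ (n : G) v = v) ∧ z.1 φ - z'.1 φ = X.ρ φ v - v :=
  oneCocycleClass_eq_iff_of_vanishing X hXc (dense_mul_zpowers_of_dense N φ hφ) z z' hz hz'

/-- **`H¹_ur(G, X) ↠ X^N/(φ − 1)X^N`**: for `G` profinite, `N ⊴ G` closed with `G ⧸ N` free procyclic,
`φ ∈ G` whose image topologically generates `G ⧸ N`, `X` Hausdorff, and `t ∈ X^N` satisfying (KM4)
on `cl⟨φ⟩`: there is an `N`-vanishing continuous cocycle `z` of `G` with `z(φ) = t` (whose class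
lies in `ker res_N`, `resSubgroup_oneCocycleClass_eq_zero_of_vanishing`).  Together with
`oneCocycleClass_eq_iff_of_vanishing_of_dense` and `exists_rep_vanishing_of_resSubgroup_eq_zero`:
`ker(H¹(G, X) → H¹(N, X)) ≅ X^N/(φ − 1)X^N` via `[z] ↦ z(φ)` — "`H¹(Ẑ, T^N) = T^N/(F − 1)T^N`" for
profinite `T`. [cite: SerreLocalFields1979, XIII §1 Prop. 1] [cite: Rubin2000, Lemma 1.3.2] -/
theorem exists_vanishing_apply_eq_of_isFreeProcyclic (N : Subgroup G) [N.Normal]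
    (hN : IsClosed (N : Set G)) (hfree : FundamentalExtension.IsFreeProcyclic (G ⧸ N)) (φ : G)
    (hφ : Dense (zpowers (QuotientGroup.mk φ : G ⧸ N) : Set (G ⧸ N)))
    {t : X} (ht : ∀ n : N, X.ρ (n : G) t = t)
    (hKM4 : ∃ y : contOneCocycles (subgroupRep X (zpowers φ).topologicalClosure),
      y.1 ⟨φ, le_topologicalClosure _ (mem_zpowers φ)⟩ = t) :
    ∃ z : contOneCocycles X, (∀ n : N, z.1 n = 0) ∧ z.1 φ = t := by
  obtain ⟨r, hrC, hrid, hker⟩ := exists_continuousMonoidHom_retraction_of_isFreeProcyclic N hN hfree φ hφ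
  exact exists_vanishing_apply_eq X r hrC hrid hker (dense_zpowers_mk_topologicalClosure' φ) ht hKM4

end FreeProcyclic

end Literature.NumberTheory.GaloisRepresentations

end
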